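import Summits.SmoothPoincare4.SmoothPoincare4.Theses.CongruenceShadows

/-!
# `WaldhausenPairs` — negative-side support (2): stabilisers do not transfer

Refuter negative lemma (cdisprove seat) for crux item stmt-SmoothPoincare4-14592
(`CongruenceShadows.WaldhausenPairs`). The NATURAL STRENGTHENING `PairTransfer` — "every
automorphism `α` with `α(N_i) = K_i` also satisfies `α(N_j) = K_j`" — is FALSE already for the
standard triple of `S⁴` at genus `3` (`m = 0`, `K = N = s4Kernels`): the Dehn twist / transvection
`τ : b₂ ↦ b₂a₂` (an automorphism of `S_3`, `twistEquiv`) fixes `N₀ = ⟪a₁,a₂,b₃⟫` and moves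
`N₁ = ⟪a₁,b₂,a₃⟫` (`τ b₂ = b₂a₂ ∉ N₁`). Moral: the stabiliser of one handlebody kernel is not
inside the stabiliser of the other (handlebody group ≠ Heegaard group), so the two single-kernel
standardisations supplied by Leininger–Reid cannot be performed one at a time; the simultaneous
automorphism is exactly Waldhausen's theorem on `Hᵢ ∪ Hⱼ ≅ #ᵏ(S¹ × S²)`.

Also: `IsGroupTrisection.map_mulEquiv` — the hypothesis of the crux is invariant under
`K ↦ α • K` (transport along an automorphism of `S_g`; Abrams–Gay–Kirby 2018 §2), and
`not_rigid` — `τ • N` is a `(3,1)` group trisection of the trivial group agreeing with `N` in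
slot `0` and differing in slot `1`, so the hypothesis never determines `K_j` from `K_i`
(`α = 1` / inner automorphisms never suffice).
-/

-- the prescribed namespace `Summit.<P>.<Sub>.…` duplicates `SmoothPoincare4` (P = Sub)
set_option linter.dupNamespace false

noncomputable section

namespace Summit.SmoothPoincare4.SmoothPoincare4.Theorems.WaldhausenPairs.Negative

open Literature.Topology.FourManifolds Subgroup

/-! ## The Dehn twist `τ : b₂ ↦ b₂ a₂` on `S_3` and the refutation of `PairTransfer` -/

/-- Generator images of the transvection `τ : b₂ ↦ b₂ a₂` (0-indexed handle `1`; a Dehn twist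
about `a₂`), on the free group. [folklore] -/
def twistGen (x : surfaceGen 3) : FreeGroup (surfaceGen 3) :=
  if x = ((1 : Fin 3), true) then FreeGroup.of ((1 : Fin 3), true) * FreeGroup.of ((1 : Fin 3), false)
  else FreeGroup.of x

/-- Generator images of `τ⁻¹ : b₂ ↦ b₂ a₂⁻¹`. [folklore] -/
def untwistGen (x : surfaceGen 3) : FreeGroup (surfaceGen 3) :=
  if x = ((1 : Fin 3), true) then FreeGroup.of ((1 : Fin 3), true) * (FreeGroup.of ((1 : Fin 3), false))⁻¹
  else FreeGroup.of x

/-- `τ` fixes each commutator `[aᵢ, bᵢ]` in the free group. [folklore] -/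
theorem lift_twistGen_comm (i : Fin 3) :
    FreeGroup.lift twistGen (genA i * genB i * (genA i)⁻¹ * (genB i)⁻¹) =
      genA i * genB i * (genA i)⁻¹ * (genB i)⁻¹ := by
  fin_cases i
  · simp [twistGen, genA, genB]
  · simp only [twistGen, genA, genB, map_mul, map_inv, FreeGroup.lift_apply_of]
    simp
    group
  · simp [twistGen, genA, genB]

/-- `τ⁻¹` fixes each commutator `[aᵢ, bᵢ]` in the free group. [folklore] -/
theorem lift_untwistGen_comm (i : Fin 3) :
    FreeGroup.lift untwistGen (genA i * genB i * (genA i)⁻¹ * (genB i)⁻¹) =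
      genA i * genB i * (genA i)⁻¹ * (genB i)⁻¹ := by
  fin_cases i
  · simp [untwistGen, genA, genB]
  · simp only [untwistGen, genA, genB, map_mul, map_inv, FreeGroup.lift_apply_of]
    simp
    group
  · simp [untwistGen, genA, genB]

/-- `τ` fixes the surface relator (already in the free group). [folklore] -/
theorem lift_twistGen_surfaceRelator :
    FreeGroup.lift twistGen (surfaceRelator 3) = surfaceRelator 3 := by
  unfold surfaceRelator
  rw [map_list_prod, List.map_map]
  exact congrArg List.prod (List.map_congr_left fun i _ => lift_twistGen_comm i)

/-- `τ⁻¹` fixes the surface relator. [folklore] -/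
theorem lift_untwistGen_surfaceRelator :
    FreeGroup.lift untwistGen (surfaceRelator 3) = surfaceRelator 3 := by
  unfold surfaceRelator
  rw [map_list_prod, List.map_map]
  exact congrArg List.prod (List.map_congr_left fun i _ => lift_untwistGen_comm i)

/-- The transvection `τ` as an endomorphism of `S_3`. [folklore] -/
def twistHom : SurfaceGroup 3 →* SurfaceGroup 3 :=
  presentedLift ((PresentedGroup.mk _).comp (FreeGroup.lift twistGen)) (by
    intro r hr
    rw [Set.mem_singleton_iff] at hr
    subst hr
    rw [MonoidHom.comp_apply, lift_twistGen_surfaceRelator]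
    exact PresentedGroup.one_of_mem (Set.mem_singleton _))

/-- `τ⁻¹` as an endomorphism of `S_3`. [folklore] -/
def untwistHom : SurfaceGroup 3 →* SurfaceGroup 3 :=
  presentedLift ((PresentedGroup.mk _).comp (FreeGroup.lift untwistGen)) (by
    intro r hr
    rw [Set.mem_singleton_iff] at hr
    subst hr
    rw [MonoidHom.comp_apply, lift_untwistGen_surfaceRelator]
    exact PresentedGroup.one_of_mem (Set.mem_singleton _))

/-- `τ` on the class of a word. [folklore] -/
@[simp] theorem twistHom_mk (w : FreeGroup (surfaceGen 3)) :
    twistHom (PresentedGroup.mk _ w) = PresentedGroup.mk _ (FreeGroup.lift twistGen w) := by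
  simp [twistHom]

/-- `τ⁻¹` on the class of a word. [folklore] -/
@[simp] theorem untwistHom_mk (w : FreeGroup (surfaceGen 3)) :
    untwistHom (PresentedGroup.mk _ w) = PresentedGroup.mk _ (FreeGroup.lift untwistGen w) := by
  simp [untwistHom]

/-- The transvection `τ : b₂ ↦ b₂a₂` as an automorphism of `S_3` (a Dehn twist). [folklore] -/
def twistEquiv : SurfaceGroup 3 ≃* SurfaceGroup 3 :=
  MonoidHom.toMulEquiv twistHom untwistHom
    (PresentedGroup.ext fun x => by
      obtain ⟨k, b⟩ := x
      fin_cases k <;> cases b <;> simp [twistGen, untwistGen, PresentedGroup.of])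
    (PresentedGroup.ext fun x => by
      obtain ⟨k, b⟩ := x
      fin_cases k <;> cases b <;> simp [twistGen, untwistGen, PresentedGroup.of])

/-- `τ` fixes every `aᵢ`. [folklore] -/
theorem twistEquiv_a (i : Fin 3) : twistEquiv (SurfaceGroup.a i) = SurfaceGroup.a i := by
  fin_cases i <;> simp [twistEquiv, SurfaceGroup.a, twistGen, PresentedGroup.of]

/-- `τ` fixes `b₁`. [folklore] -/
theorem twistEquiv_b_zero : twistEquiv (SurfaceGroup.b 0) = SurfaceGroup.b 0 := by
  simp [twistEquiv, SurfaceGroup.b, twistGen, PresentedGroup.of]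

/-- `τ` fixes `b₃`. [folklore] -/
theorem twistEquiv_b_two : twistEquiv (SurfaceGroup.b 2) = SurfaceGroup.b 2 := by
  simp [twistEquiv, SurfaceGroup.b, twistGen, PresentedGroup.of]

/-- `τ b₂ = b₂ a₂`. [folklore] -/
theorem twistEquiv_b_one :
    twistEquiv (SurfaceGroup.b 1) = SurfaceGroup.b 1 * SurfaceGroup.a 1 := by
  simp [twistEquiv, SurfaceGroup.b, SurfaceGroup.a, twistGen, PresentedGroup.of]

/-- `τ` stabilises `N₀ = ⟪a₁, a₂, b₃⟫`. [folklore] -/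
theorem map_twist_s4Kernels_zero :
    (s4Kernels 0).map twistEquiv.toMonoidHom = s4Kernels 0 := by
  have h0 : s4Kernels 0 = normalClosure {SurfaceGroup.a 0, SurfaceGroup.a 1, SurfaceGroup.b 2} := rfl
  rw [h0, map_normalClosure _ twistEquiv.toMonoidHom (by exact twistEquiv.surjective)]
  congr 1
  simp [Set.image_insert_eq, Set.image_singleton, twistEquiv_a, twistEquiv_b_two]

/-- … but `τ` moves `N₁ = ⟪a₁, b₂, a₃⟫`: `τ(b₂) = b₂a₂ ∈ τ(N₁)` while `b₂a₂ ∉ N₁` (erase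
`{a₁,b₂,a₃}`: `b₂a₂ ↦ a₂ ≠ 1`). [folklore] -/
theorem map_twist_s4Kernels_one_ne :
    (s4Kernels 1).map twistEquiv.toMonoidHom ≠ s4Kernels 1 := by
  intro h
  have hmem : SurfaceGroup.b 1 * SurfaceGroup.a 1 ∈ s4Kernels 1 := by
    rw [← h, ← twistEquiv_b_one]
    exact Subgroup.mem_map_of_mem _ (of_mem_s4Kernels 1 (x := ((1 : Fin 3), true)) (by decide))
  have hker := s4Kernels_le_ker (s4Gens 1) (s4Gens_hits 1) 1 le_rfl hmem
  rw [MonoidHom.mem_ker, map_mul] at hker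
  change eraseHom _ _ (PresentedGroup.of _) * eraseHom _ _ (PresentedGroup.of _) = 1 at hker
  rw [eraseHom_of, eraseHom_of, eraseGen_of_mem (by decide),
    eraseGen_of_not_mem (by decide), one_mul] at hker
  exact FreeGroup.of_ne_one _ hker

/-- REFUTED STRENGTHENING: `PairTransfer` fails already for `S⁴` itself (`m = 0`, `K = N`,
`α = τ` the Dehn twist `b₂ ↦ b₂a₂`: `τ N₀ = N₀`, `τ N₁ ≠ N₁`). Moral for provers: the stabiliser
of one handlebody kernel (a handlebody group) is not inside the stabiliser of the other, so the
two single-kernel standardisations (Leininger–Reid) cannot be chained; the simultaneous `α` is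
Waldhausen's theorem on the Heegaard splitting `Hᵢ ∪ Hⱼ ≅ #ᵏ S¹×S²`. [folklore] -/
theorem not_pairTransfer :
    ¬ (∀ (m : ℕ) (K : TrisectionKernels (3 + 3 * m)),
      IsGroupTrisection (3 + 3 * m) (m + 1) (PUnit : Type) K →
      ∀ i j : Fin 3, i ≠ j → ∀ α : SurfaceGroup (3 + 3 * m) ≃* SurfaceGroup (3 + 3 * m),
        (s4Kernels.stabilizeIter m i).map α.toMonoidHom = K i →
        (s4Kernels.stabilizeIter m j).map α.toMonoidHom = K j) := fun h =>
  map_twist_s4Kernels_one_ne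
    (h 0 s4Kernels s4Kernels_isGroupTrisection_holds 0 1 (by decide) twistEquiv
      map_twist_s4Kernels_zero)

/-! ## Transport: the hypothesis is `Aut(S_g)`-invariant; it does not pin `K` (not rigid) -/

section transport

variable {g' k : ℕ} {G : Type*} [Group G]

/-- Images of the generators of a normal closure generate the image (for a surjection).
[folklore] -/
theorem map_normalClosure_coe (α : SurfaceGroup g' ≃* SurfaceGroup g') (s : Set (SurfaceGroup g')) :
    (normalClosure s).map (α : SurfaceGroup g' →* SurfaceGroup g') = normalClosure (α '' s) := by
  rw [map_normalClosure _ _ (by exact α.surjective)]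
  rfl

/-- TRANSPORT: the trisection property is invariant under automorphisms of `S_g`
(`K ↦ α • K`); in particular the set of `K` satisfying the hypothesis of the crux is a union of
`Aut(S_g)`-orbits containing the orbit of `N`. [cite: AbramsGayKirby2018, §2] -/
theorem IsGroupTrisection.map_mulEquiv {K : TrisectionKernels g'} (hK : IsGroupTrisection g' k G K)
    (α : SurfaceGroup g' ≃* SurfaceGroup g') :
    IsGroupTrisection g' k G (fun i => (K i).map α.toMonoidHom) := by
  have hsurj : Function.Surjective α.toMonoidHom := α.surjective
  refine ⟨fun i => Subgroup.Normal.map (hK.normal i) _ hsurj, fun i => ?_, fun i j hij => ?_, ?_⟩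
  · refine (hK.free_quotient i).of_mulEquiv (QuotientGroup.congr _ _ α ?_)
    rw [map_normalClosure_coe]
    simp [Subgroup.coe_map]
  · refine (hK.free_pairQuotient i j hij).of_mulEquiv (QuotientGroup.congr _ _ α ?_)
    rw [map_normalClosure_coe]
    simp [Subgroup.coe_map, Set.image_union]
  · obtain ⟨e⟩ := hK.triple
    refine ⟨(QuotientGroup.congr _ _ α ?_).symm.trans e⟩
    rw [map_normalClosure_coe]
    simp [Subgroup.coe_map, Set.image_iUnion]

end transport

/-- NOT RIGID (refuted strengthening "`α = 1` suffices pairwise"): `τ • N` (the image of the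
standard genus-3 triple under the Dehn twist `τ`) is a `(3,1)` group trisection of the trivial
group with `(τ•N)₀ = N₀` but `(τ•N)₁ ≠ N₁`. So the hypothesis does not determine `K_j` from
`K_i`, the `∃ α` genuinely ranges over `Aut(S_g)`, and inner automorphisms never suffice
(they fix normal subgroups). [folklore] -/
theorem not_rigid :
    ¬ ∀ (m : ℕ) (K : TrisectionKernels (3 + 3 * m)),
      IsGroupTrisection (3 + 3 * m) (m + 1) (PUnit : Type) K →
      ∀ i j : Fin 3, i ≠ j → s4Kernels.stabilizeIter m i = K i → s4Kernels.stabilizeIter m j = K j := by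
  intro h
  have hK := IsGroupTrisection.map_mulEquiv s4Kernels_isGroupTrisection_holds twistEquiv
  exact map_twist_s4Kernels_one_ne
    (h 0 _ hK 0 1 (by decide) map_twist_s4Kernels_zero.symm).symm

end Summit.SmoothPoincare4.SmoothPoincare4.Theorems.WaldhausenPairs.Negative

end
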